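import Literature.NumberTheory.EllipticCurves.SupersingularInertiaShapeProofs
import HarnessLib

/-!
# The inertia shape `diag(ψ₂^p, ψ₂)` from an additive embedding that is equivariant for a FROBENIUS TWIST
# `ψ₂^{p^r}` of the level-two fundamental character (proofs)

`Proofs` file (theorems only: no definition, no named fact, no instance, no `sorry`), topic
`NumberTheory/EllipticCurves`; a two-step sequel of `SupersingularInertiaShapeProofs`
(`WeierstrassCurve.IsTorsionGaloisRep.hasLevelTwoInertiaShape_of_additive_equivariant`: an additive, injective,
`ψ₂`-equivariant `θ : E[p] → k` forces `ρ̄|I ≃ diag(ψ₂^q, ψ₂)`).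

WHAT. In Serre's analysis of the tame inertia action on the `p`-torsion of a curve acquiring good SUPERSINGULAR
reduction over a tamely ramified extension (Serre, Invent. Math. 15 (1972), §1.10–§1.11 for `e = 1`; for `e > 1` the
graded piece of the formal group in which `E[p] ∖ 0` sits carries the character `θ_{q²-1}^{a} · θ_e^{-b}`, a power
`ψ₂^m` of the level-two fundamental character), the additive embedding `θ : E[p] ↪ k̄` one constructs is
`ψ₂^m`-equivariant for some exponent `m`, not `ψ₂`-equivariant. When `m = p^r` is a power of `p` (e.g. `m = p`,
the case of the Kodaira-III* half of the tame quartic class at `p = 3`, where the character is `ψ₂³`), composing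
`θ` with the `r`-th power of Frobenius of `k` (additive and injective in characteristic `p`) gives a
`ψ₂^{p^{2r}} = ψ₂`-equivariant embedding, because `ψ₂^{p²} = ψ₂` (`ψ₂^{p²-1} = 1`,
`fundamentalCharacter_pow_eq_one`). Hence:

* `WeierstrassCurve.IsTorsionGaloisRep.hasLevelTwoInertiaShape_of_additive_equivariant_pow` — an additive,
  injective `θ : E[p] → k` with `θ(σ X) = ψ₂(σ)^{p^r} θ(X)` on inertia forces the level-two inertia shape
  `(0, 1)` of Serre's recipe for `(ρ̄ ⊗_j k)|Γ_{K_v}`;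
* `WeierstrassCurve.serreWeight_eq_two_of_additive_equivariant_pow` — over `ℚ`, at the canonical local
  restriction datum `F = ℚ_v` (`v ∣ p`), such a `θ` gives Serre weight `k(ρ̄) = 2`
  (`serreWeight_eq_two_of_hasLevelTwoInertiaShape_zero_one`, Serre 1987 (2.8.1)).

This isolates the remaining ANALYTIC input (the construction of `θ` from the formal group of a twisted good model)
from the representation-theoretic conclusion. Nothing about any particular curve is proved here.

References: [SerreInventiones1972] J.-P. Serre, Invent. Math. 15 (1972), §1.7 Prop. 3, §1.10 Prop. 10, §1.11
Prop. 12; [Serre1987] J.-P. Serre, Duke Math. J. 54 (1987), §2.2, §2.8 Prop. 3 (2.8.1).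
-/

noncomputable section

open scoped Classical NumberField

namespace Literature.NumberTheory.EllipticCurves

open _root_.WeierstrassCurve Literature.NumberTheory.GaloisRepresentations Field
  IsDedekindDomain IsDedekindDomain.HeightOneSpectrum
  Literature.NumberTheory.GaloisRepresentations.IsNonarchimedeanLocalField
  Literature.NumberTheory.GaloisRepresentations.ModPGaloisRep ValuativeRel

/-- **`ψ₂(σ)^{p^{2r}} = ψ₂(σ)`** for the level-two fundamental character of a local field with residue field of
cardinality `p`: `ψ₂^{p²-1} = 1` (`fundamentalCharacter_pow_eq_one`), so `x ↦ x^{p²}` fixes its values, and by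
induction so does `x ↦ x^{p^{2r}}`. [cite: SerreInventiones1972, §1.7 Prop. 3] -/
theorem coe_fundamentalCharacter_two_pow_pow_sq {F : Type} [Field F] [ValuativeRel F] [TopologicalSpace F]
    [IsNonarchimedeanLocalField F] {k : Type} [Field k] [TopologicalSpace k] {p : ℕ}
    (ι : absIntegers 𝒪[F] F ⧸ absMaximalIdeal F →+* k) (ϖ : 𝒪[F]) (hϖ : Irreducible ϖ)
    (hq : residueFieldCard F = p) (σ : absInertia F) (r : ℕ) :
    ((fundamentalCharacter F 2 ι ϖ hϖ σ : kˣ) : k) ^ (p ^ (2 * r)) =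
      (fundamentalCharacter F 2 ι ϖ hϖ σ : k) := by
  set x : k := (fundamentalCharacter F 2 ι ϖ hϖ σ : k) with hx
  have hone : x ^ (p ^ 2 - 1) = 1 := by
    have h := InertiaShape.fundamentalCharacter_pow_eq_one (F := F) (k := k) (m := 2) two_ne_zero ι ϖ hϖ
    have h' := congrArg (fun χ : absInertia F →* kˣ ↦ ((χ σ : kˣ) : k)) h
    simpa only [MonoidHom.pow_apply, Units.val_pow_eq_pow_val, MonoidHom.one_apply, Units.val_one, hq] using h'
  have hsq : x ^ (p ^ 2) = x := by
    have hp : 1 ≤ p ^ 2 := Nat.one_le_pow _ _ (by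
      rcases Nat.eq_zero_or_pos p with h0 | h0
      · subst h0
        have := one_lt_residueFieldCard F
        omega
      · exact h0)
    calc x ^ (p ^ 2) = x ^ (p ^ 2 - 1 + 1) := by rw [Nat.sub_add_cancel hp]
      _ = x := by rw [pow_succ, hone, one_mul]
  induction r with
  | zero => simp
  | succ r ih =>
    rw [Nat.mul_succ, pow_add, pow_mul, ih, hsq]

/-- **From a `ψ₂^{p^r}`-equivariant additive embedding to the inertia shape `diag(ψ₂^q, ψ₂)`.** In the setting of
`IsTorsionGaloisRep.hasLevelTwoInertiaShape_of_additive_equivariant` (a framing `ρ̄` of `E[p]`, `j : 𝔽_p → k`, a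
uniformiser `ϖ` of `K_v`, residue embedding `ι`, `#k_v = p`), let `θ : E(K̄) → k` be additive and injective on
`E[p]` with `θ(σ X) = ψ₂(σ)^{p^r} θ(X)` for `σ` in the inertia group of `K_v`. Then `(ρ̄ ⊗_j k)|Γ_{K_v}` has
`HasLevelTwoInertiaShape ι ϖ hϖ 0 1`: apply the `ψ₂`-equivariant case to `θ' = Frob^r ∘ θ`, `θ'(X) = θ(X)^{p^r}`,
which is additive (`(a + b)^{p^r} = a^{p^r} + b^{p^r}` in characteristic `p`), injective, and satisfies
`θ'(σ X) = ψ₂(σ)^{p^{2r}} θ'(X) = ψ₂(σ) θ'(X)`. [cite: SerreInventiones1972, §1.10 Prop. 10, §1.11 Prop. 12] -/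
theorem _root_.WeierstrassCurve.IsTorsionGaloisRep.hasLevelTwoInertiaShape_of_additive_equivariant_pow
    {K : Type} [Field K] [NumberField K]
    {W : WeierstrassCurve K} [W.IsElliptic] {p : ℕ} [hp : Fact p.Prime]
    (v : HeightOneSpectrum (𝓞 K)) {ρ : ModPGaloisRep K (ZMod p) 2} (hρ : W.IsTorsionGaloisRep p ρ)
    {k : Type} [Field k] [TopologicalSpace k] (j : ZMod p →+* k) (hj : Continuous j)
    {ϖ : 𝒪[v.adicCompletion K]} (hϖ : Irreducible ϖ)
    (ι : absIntegers 𝒪[v.adicCompletion K] (v.adicCompletion K) ⧸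
      absMaximalIdeal (v.adicCompletion K) →+* k)
    (hq : residueFieldCard (v.adicCompletion K) = p)
    (θ : geomPoints W → k) (r : ℕ)
    (hθadd : ∀ X ∈ geomTorsion W p, ∀ Y ∈ geomTorsion W p, θ (X + Y) = θ X + θ Y)
    (hθinj : ∀ X ∈ geomTorsion W p, θ X = 0 → X = 0)
    (hθsmul : ∀ (σ : absInertia (v.adicCompletion K)), ∀ X ∈ geomTorsion W p,
      θ (absGaloisRestrict K (v.adicCompletion K)
          (σ : absoluteGaloisGroup (v.adicCompletion K)) • X) =
        (fundamentalCharacter (v.adicCompletion K) 2 ι ϖ hϖ σ : k) ^ (p ^ r) * θ X) :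
    ModPGaloisRep.HasLevelTwoInertiaShape
      (FramedGaloisRep.restrictField (v.adicCompletion K) (FramedRep.baseChange j hj ρ) :
        ModPGaloisRep (v.adicCompletion K) k 2) ι ϖ hϖ 0 1 := by
  haveI : CharP k p := charP_of_injective_ringHom j.injective p
  refine hρ.hasLevelTwoInertiaShape_of_additive_equivariant v j hj hϖ ι hq (fun X ↦ θ X ^ (p ^ r))
    ?_ ?_ ?_
  · intro X hX Y hY
    simp only [hθadd X hX Y hY, add_pow_char_pow]
  · intro X hX h0
    exact hθinj X hX (pow_eq_zero_iff (pow_ne_zero r hp.out.ne_zero) |>.mp h0)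
  · intro σ X hX
    simp only [hθsmul σ X hX, mul_pow, ← pow_mul]
    rw [show p ^ r * p ^ r = p ^ (2 * r) by rw [two_mul, pow_add],
      coe_fundamentalCharacter_two_pow_pow_sq ι ϖ hϖ hq σ r]

/-- **Serre weight `2` from a `ψ₂^{p^r}`-equivariant additive embedding, at the canonical local datum over `ℚ`.**
For an elliptic `W/ℚ`, a prime `p`, a place `v` of `ℚ` with `#k_v = p` and `p` a uniformiser of `ℚ_v` (both
automatic for `v ∣ p`; supplied by the caller, e.g. the tree's `residueFieldCard_adicCompletion_eq_of_natCast_mem`,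
`irreducible_natCast_valuativeInteger_adicCompletion_of_natCast_mem`), a framing `ρ̄` of `E[p]`, a discrete
coefficient field `k ⊇ 𝔽_p` (`j`), a residue embedding `ι` for `ℚ_v`, and `θ : E(ℚ̄) → k` additive and injective on
`E[p]` with `θ(σ X) = ψ₂(σ)^{p^r} θ(X)` on the inertia group of `ℚ_v` (`ψ₂` w.r.t. the uniformiser `p`): Serre's
weight of `ρ̄ ⊗_j k` at the local restriction datum `F = ℚ_v` is `2` (Serre 1987 (2.8.1)).
[cite: Serre1987, §2.8 Prop. 3 (2.8.1)] [cite: SerreInventiones1972, §1.11 Prop. 12] -/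
theorem _root_.WeierstrassCurve.serreWeight_eq_two_of_additive_equivariant_pow
    (W : WeierstrassCurve ℚ) [W.IsElliptic] (p : ℕ) [hp : Fact p.Prime] (v : HeightOneSpectrum (𝓞 ℚ))
    (hq : residueFieldCard (v.adicCompletion ℚ) = p) (hirr : Irreducible ((p : ℕ) : 𝒪[v.adicCompletion ℚ]))
    {ρ : ModPGaloisRep ℚ (ZMod p) 2} (hρ : W.IsTorsionGaloisRep p ρ)
    (k : Type) [Field k] [TopologicalSpace k] [DiscreteTopology k] (j : ZMod p →+* k)
    (ι : absIntegers 𝒪[v.adicCompletion ℚ] (v.adicCompletion ℚ) ⧸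
      absMaximalIdeal (v.adicCompletion ℚ) →+* k)
    (θ : geomPoints W → k) (r : ℕ)
    (hθadd : ∀ X ∈ geomTorsion W p, ∀ Y ∈ geomTorsion W p, θ (X + Y) = θ X + θ Y)
    (hθinj : ∀ X ∈ geomTorsion W p, θ X = 0 → X = 0)
    (hθsmul : ∀ (σ : absInertia (v.adicCompletion ℚ)), ∀ X ∈ geomTorsion W p,
      θ (absGaloisRestrict ℚ (v.adicCompletion ℚ)
          (σ : absoluteGaloisGroup (v.adicCompletion ℚ)) • X) =
        (fundamentalCharacter (v.adicCompletion ℚ) 2 ι ((p : ℕ) : 𝒪[v.adicCompletion ℚ]) hirr σ : k) ^ (p ^ r) *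
          θ X) :
    serreWeight p (FramedRep.baseChange j continuous_of_discreteTopology ρ)
      { F := v.adicCompletion ℚ
        residueFieldCard_eq := hq
        irreducible_natCast := hirr
        rep := FramedGaloisRep.restrictField (v.adicCompletion ℚ)
          (FramedRep.baseChange j continuous_of_discreteTopology ρ)
        rep_eq_restrictField := rfl } ι = 2 := by
  refine serreWeight_eq_two_of_hasLevelTwoInertiaShape_zero_one _ _ ?_
  change ModPGaloisRep.HasLevelTwoInertiaShape (FramedGaloisRep.restrictField (v.adicCompletion ℚ)
      (FramedRep.baseChange j continuous_of_discreteTopology ρ)) ι ((p : ℕ) : 𝒪[v.adicCompletion ℚ]) hirr 0 1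
  exact hρ.hasLevelTwoInertiaShape_of_additive_equivariant_pow v j continuous_of_discreteTopology hirr ι hq θ r
    hθadd hθinj hθsmul

end Literature.NumberTheory.EllipticCurves

end
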